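import Summits.MatrixMultiplication.OmegaCensus.STPP222Pow4Cyclic
import Summits.MatrixMultiplication.OmegaCensus.STPP222SqFrom24
import Summits.MatrixMultiplication.OmegaCensus.STPP222OneFrom8
import Summits.MatrixMultiplication.OmegaCensus.STPPPatternMonotonicity
import Mathlib.GroupTheory.FiniteAbelian.Basic
import Mathlib.Algebra.DirectSum.Module
import Mathlib.Logic.Equiv.Fin.Basic

/-!
# ω-census, STPP laws `(2,2,2)^k`: EVERY large finite abelian group admits them (`N₄ ≤ 16 900`; `N_k < ∞` for all `k`)

HONEST FRAMING (pub-omega census; verbatim): lottery ticket; floor = certified bounds/negative ranges.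
Census STRUCTURE bookkeeping (question Q7 of the pub-omega cell: the uniform threshold `N_k` = least order from which
EVERY finite abelian group admits `k` simultaneous-TPP triples of 2-subsets, CKSU 2005 Def. 5.1, tree form `IsSTPP`),
not progress on `ω`: a `(2,2,2)^k` family has volume `8k` and certifies no matrix-multiplication bound of any interest.

Main statements:
* `exists_isSTPP_222pow4_of_card` — **every finite abelian group `G` with `16 900 ≤ |G|` admits `(2,2,2)⁴`**
  (`A B C : Fin 4 → Finset G`, all of cardinality `2`, `IsSTPP A B C`).  So `N₄` is FINITE, `N₄ ≤ 16 900` (crude; the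
  census engines have `ℤ/56 ⊉ (2,2,2)⁴`, i.e. `N₄ ≥ 57`, and suggest the true value is below `100`; no sharpness claimed).
* `exists_isSTPP_222pow_of_card_ge` — **for every `k`, every finite abelian group of order `≥ (416 k² + 416)^k` admits
  `(2,2,2)^k`**: `N_k < ∞` for all `k`, with an explicit (very crude) envelope; the recursion in the proof is
  `B(k) = 26 · O(k²) · B(⌈k/2⌉)`, i.e. quasi-polynomial `k^{O(log k)}`; the tree's packing bound gives `N_k ≥ 8k − 4`
  (`card_ge_of_isSTPP_222pow`) and `STPP222PowCyclic.lean` gives the EXPONENT form (exponent `≥ 8k(k−1)+8` suffices).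

Proof (no search, no new witnesses — a combination of landed theorems):
1. Large exponent: `exists_isSTPP_2224_of_exponent_ge` (`≥ 72`, `STPP222Pow4Cyclic.lean`) for `k = 4`, and
   `exists_isSTPP_222pow_of_exponent` (`≥ 8k(k−1)+8`, `STPP222PowCyclic.lean`) in general.
2. Small exponent: `G ≃+ Π i, ℤ/qᵢ` with all `qᵢ` dividing the exponent (structure theorem
   `AddCommGroup.equiv_directSum_zmod_of_finite`, packaged as `exists_addEquiv_pi_zmod`).  A greedy block `S` of indices
   (`exists_subset_prod_window`) has `26 ≤ ∏_{i∈S} qᵢ < 26 · (max qᵢ)`, so for `|G|` large the complementary block is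
   large too (`Finset.prod_mul_prod_compl`).
3. The block `Π_{i∈S} ℤ/qᵢ` carries `(2,2,2)²` (`exists_isSTPP_222sq_of_card`, Pb47: every finite abelian group of order
   `≥ 26`); the complementary block carries `(2,2,2)²` (for `k = 4`) or, by strong induction, `(2,2,2)^{⌈k/2⌉}`.  The
   two families MULTIPLY (CKSU 2005: simultaneous TPP families in `H₁`, `H₂` give all products in `H₁ × H₂`; the
   two-line argument is inlined in `exists_isSTPP_222pow_prod`, cf. `STPPProductFamilies.lean`), the product shrinks
   back to 2-subsets and to the wanted number of triples (`isSTPP_mono`, `isSTPP_subfamily`), and is transported along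
   the injection `(Π_{i∈S} ℤ/qᵢ) × (Π_{i∉S} ℤ/qᵢ) ↪ Π i, ℤ/qᵢ ≃ G` (`exists_prodPi_injective`,
   `exists_isSTPP_222pow_of_injective`).

References: H. Cohn, R. Kleinberg, B. Szegedy, C. Umans, *Group-theoretic algorithms for matrix multiplication*, FOCS 2005
(arXiv:math/0511460), Def. 5.1 and the product remark of its §7.  Record: pub-omega HOME `STATUS.md` 2026-08-23 (stpp-3
gen 6), `STRUCTURE.md` Q7.
-/

open Literature.Computability.AlgebraicComplexity Finset

namespace Summit.MatrixMultiplication.OmegaCensus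

/-! ## 1. Products of `(2,2,2)`-families (CKSU product, shrunk back to 2-subsets) -/

/-- **Product-and-shrink.** If `H₁` carries `a` and `H₂` carries `b` simultaneous-TPP triples of 2-subsets, then `H₁ × H₂`
carries `c` of them for every `c ≤ a·b`: the `a·b` product triples `(Aᵢ × A'ⱼ, Bᵢ × B'ⱼ, Cᵢ × C'ⱼ)` form an STPP family
(CKSU 2005: the two components of the defining word are the defining words of the factors), sub-sets and sub-families of
an STPP family are STPP families, and `Aᵢ × {x'ⱼ}` has two elements. [cite: CohnKleinbergSzegedyUmans2005, Def. 5.1] -/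
theorem exists_isSTPP_222pow_prod {H₁ H₂ : Type*} [AddCommGroup H₁] [AddCommGroup H₂] {a b : ℕ}
    (h₁ : ∃ A B C : Fin a → Finset H₁, IsSTPP A B C ∧ ∀ i, (A i).card = 2 ∧ (B i).card = 2 ∧ (C i).card = 2)
    (h₂ : ∃ A B C : Fin b → Finset H₂, IsSTPP A B C ∧ ∀ i, (A i).card = 2 ∧ (B i).card = 2 ∧ (C i).card = 2)
    (c : ℕ) (hc : c ≤ a * b) :
    ∃ A B C : Fin c → Finset (H₁ × H₂), IsSTPP A B C ∧ ∀ i, (A i).card = 2 ∧ (B i).card = 2 ∧ (C i).card = 2 := by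
  classical
  obtain ⟨A, B, C, hS, hc₁⟩ := h₁
  obtain ⟨A', B', C', hS', hc₂⟩ := h₂
  have hA' : ∀ j, (A' j).Nonempty := fun j => Finset.card_pos.1 (by rw [(hc₂ j).1]; norm_num)
  have hB' : ∀ j, (B' j).Nonempty := fun j => Finset.card_pos.1 (by rw [(hc₂ j).2.1]; norm_num)
  have hC' : ∀ j, (C' j).Nonempty := fun j => Finset.card_pos.1 (by rw [(hc₂ j).2.2]; norm_num)
  choose xa hxa using hA'
  choose xb hxb using hB'
  choose xc hxc using hC'
  -- the product family on `Fin (a * b)` (CKSU: STPP families multiply)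
  have hP : IsSTPP (fun m : Fin (a * b) => A (finProdFinEquiv.symm m).1 ×ˢ A' (finProdFinEquiv.symm m).2)
      (fun m => B (finProdFinEquiv.symm m).1 ×ˢ B' (finProdFinEquiv.symm m).2)
      (fun m => C (finProdFinEquiv.symm m).1 ×ˢ C' (finProdFinEquiv.symm m).2) := by
    intro i j k s hs s' hs' t ht t' ht' u hu u' hu' h0
    simp only [mem_product] at hs hs' ht ht' hu hu'
    have h1 : (s'.1 - s.1) + (t'.1 - t.1) + (u'.1 - u.1) = 0 := by
      have := congrArg Prod.fst h0; simpa using this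
    have h2 : (s'.2 - s.2) + (t'.2 - t.2) + (u'.2 - u.2) = 0 := by
      have := congrArg Prod.snd h0; simpa using this
    obtain ⟨hij₁, hjk₁, hs₁, ht₁, hu₁⟩ :=
      hS _ _ _ s.1 hs.1 s'.1 hs'.1 t.1 ht.1 t'.1 ht'.1 u.1 hu.1 u'.1 hu'.1 h1
    obtain ⟨hij₂, hjk₂, hs₂, ht₂, hu₂⟩ :=
      hS' _ _ _ s.2 hs.2 s'.2 hs'.2 t.2 ht.2 t'.2 ht'.2 u.2 hu.2 u'.2 hu'.2 h2
    exact ⟨finProdFinEquiv.symm.injective (Prod.ext hij₁ hij₂),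
      finProdFinEquiv.symm.injective (Prod.ext hjk₁ hjk₂), Prod.ext hs₁ hs₂, Prod.ext ht₁ ht₂, Prod.ext hu₁ hu₂⟩
  -- shrink the second factor of every set to one chosen point
  have hQ : IsSTPP (fun m : Fin (a * b) => A (finProdFinEquiv.symm m).1 ×ˢ {xa (finProdFinEquiv.symm m).2})
      (fun m => B (finProdFinEquiv.symm m).1 ×ˢ {xb (finProdFinEquiv.symm m).2})
      (fun m => C (finProdFinEquiv.symm m).1 ×ˢ {xc (finProdFinEquiv.symm m).2}) :=
    isSTPP_mono hP
      (fun m => product_subset_product (Subset.refl _) (singleton_subset_iff.2 (hxa _)))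
      (fun m => product_subset_product (Subset.refl _) (singleton_subset_iff.2 (hxb _)))
      (fun m => product_subset_product (Subset.refl _) (singleton_subset_iff.2 (hxc _)))
  -- keep the first `c` triples
  refine ⟨_, _, _, isSTPP_subfamily hQ (Fin.castLE hc) (Fin.castLE_injective hc), fun i => ?_⟩
  simp only [card_product, card_singleton, mul_one]
  exact ⟨(hc₁ _).1, (hc₁ _).2.1, (hc₁ _).2.2⟩

/-! ## 2. Splitting a product of cyclic groups into two large blocks -/

/-- **Greedy window lemma.** If naturals `q i ∈ [1, M]` (`M ≥ 2`) indexed by a finset `s` have product `≥ T ≥ 1`, some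
sub-finset has product in the window `[T, T·M)` (add elements one at a time and stop when the product first reaches `T`). -/
theorem exists_subset_prod_window {ι : Type*} [DecidableEq ι] (q : ι → ℕ) {T M : ℕ} (hT : 1 ≤ T) (hM : 2 ≤ M)
    (hq1 : ∀ i, 1 ≤ q i) (hqM : ∀ i, q i ≤ M) :
    ∀ s : Finset ι, T ≤ ∏ i ∈ s, q i → ∃ t ⊆ s, T ≤ ∏ i ∈ t, q i ∧ ∏ i ∈ t, q i < T * M := by
  intro s
  induction s using Finset.induction_on with
  | empty =>
      intro h
      rw [prod_empty] at h
      refine ⟨∅, Subset.refl _, by rw [prod_empty]; exact h, ?_⟩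
      rw [prod_empty]
      have hT1 : T = 1 := le_antisymm h hT
      subst hT1
      omega
  | insert a s ha ih =>
      intro h
      by_cases hs : T ≤ ∏ i ∈ s, q i
      · obtain ⟨t, hts, h1, h2⟩ := ih hs
        exact ⟨t, hts.trans (subset_insert a s), h1, h2⟩
      · push Not at hs
        refine ⟨insert a s, Subset.refl _, h, ?_⟩
        rw [prod_insert ha]
        calc q a * ∏ i ∈ s, q i < q a * T := (Nat.mul_lt_mul_left (hq1 a)).2 hs
          _ ≤ M * T := Nat.mul_le_mul_right T (hqM a)
          _ = T * M := Nat.mul_comm _ _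

/-- The two blocks of a product indexed by `S` and its complement glue back injectively into the full product
`Π i, N i` (coordinatewise; this is an isomorphism, injectivity is all that is used). [folklore] -/
theorem exists_prodPi_injective {ι : Type*} [DecidableEq ι] (N : ι → Type*) [∀ i, AddCommGroup (N i)]
    (S : Finset ι) :
    ∃ φ : ((Π i : {i // i ∈ S}, N i) × (Π i : {i // i ∉ S}, N i)) →+ (Π i, N i), Function.Injective φ := by
  refine ⟨{ toFun := fun xy j => if h : j ∈ S then xy.1 ⟨j, h⟩ else xy.2 ⟨j, h⟩,
            map_zero' := ?_, map_add' := ?_ }, ?_⟩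
  · funext j
    simp only [Prod.fst_zero, Prod.snd_zero, Pi.zero_apply]
    split <;> rfl
  · intro x y
    funext j
    simp only [Prod.fst_add, Prod.snd_add, Pi.add_apply]
    split <;> rfl
  · rintro ⟨x₁, x₂⟩ ⟨y₁, y₂⟩ hxy
    simp only [AddMonoidHom.coe_mk, ZeroHom.coe_mk] at hxy
    refine Prod.ext ?_ ?_
    · funext ⟨j, hj⟩
      have := congr_fun hxy j
      simpa only [dif_pos hj] using this
    · funext ⟨j, hj⟩
      have := congr_fun hxy j
      simpa only [dif_neg hj] using this

/-- Order of the block `Π_{i ∈ S} ℤ/qᵢ`. -/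
theorem natCard_pi_zmod_mem {ι : Type*} [Fintype ι] [DecidableEq ι] (q : ι → ℕ) (S : Finset ι) :
    Nat.card (Π i : {i // i ∈ S}, ZMod (q i)) = ∏ i ∈ S, q i := by
  rw [Nat.card_pi]
  simp only [Nat.card_zmod]
  exact (Finset.prod_subtype S (fun _ => Iff.rfl) q).symm

/-- Order of the complementary block `Π_{i ∉ S} ℤ/qᵢ`. -/
theorem natCard_pi_zmod_not_mem {ι : Type*} [Fintype ι] [DecidableEq ι] (q : ι → ℕ) (S : Finset ι) :
    Nat.card (Π i : {i // i ∉ S}, ZMod (q i)) = ∏ i ∈ Sᶜ, q i := by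
  rw [Nat.card_pi]
  simp only [Nat.card_zmod]
  exact (Finset.prod_subtype Sᶜ (fun x => by rw [Finset.mem_compl]) q).symm

/-- **Structure theorem, packaged**: a finite abelian group is `≃+ Π i, ℤ/qᵢ` for finitely many `qᵢ ≥ 1` dividing its
exponent, with `∏ qᵢ = |G|` (Mathlib's `AddCommGroup.equiv_directSum_zmod_of_finite`, as used in
`STPP222CubeFrom46.lean`). [folklore] -/
theorem exists_addEquiv_pi_zmod (G : Type*) [AddCommGroup G] [Finite G] :
    ∃ (ι : Type) (_ : Fintype ι) (q : ι → ℕ), (∀ i, 0 < q i) ∧ (∀ i, q i ∣ AddMonoid.exponent G) ∧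
      ∏ i, q i = Nat.card G ∧ Nonempty (G ≃+ (Π i, ZMod (q i))) := by
  classical
  obtain ⟨ι, _, p, hp, e, ⟨g⟩⟩ := AddCommGroup.equiv_directSum_zmod_of_finite G
  let f : G ≃+ (Π i, ZMod (p i ^ e i)) :=
    g.trans (DirectSum.linearEquivFunOnFintype ℕ ι (fun i => ZMod (p i ^ e i))).toAddEquiv
  refine ⟨ι, inferInstance, fun i => p i ^ e i, fun i => pow_pos (hp i).pos _, fun i => ?_, ?_, ⟨f⟩⟩
  · show p i ^ e i ∣ AddMonoid.exponent G
    have hinj : Function.Injective (AddMonoidHom.single (fun j => ZMod (p j ^ e j)) i) :=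
      Pi.single_injective (M := fun j => ZMod (p j ^ e j)) i
    have h1 : addOrderOf (f.symm (AddMonoidHom.single (fun j => ZMod (p j ^ e j)) i 1)) = p i ^ e i := by
      rw [AddEquiv.addOrderOf_eq, addOrderOf_injective _ hinj, ZMod.addOrderOf_one]
    rw [← h1]
    exact AddMonoid.addOrder_dvd_exponent _
  · rw [Nat.card_congr f.toEquiv, Nat.card_pi]
    simp [Nat.card_zmod]

/-! ## 3. `N₄ < ∞` -/

/-- **Every finite abelian group of order `≥ 16 900` admits four simultaneous-TPP triples of 2-subsets** (the census
pattern `(2,2,2)⁴`; so the uniform threshold `N₄` of STRUCTURE Q7 is finite, `N₄ ≤ 16 900` — crude, no sharpness claimed).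
Exponent `≥ 72`: the cyclic theorem.  Exponent `≤ 71`: split `Π ℤ/qᵢ` into two blocks of order `≥ 26`, put `(2,2,2)²`
in each (Pb47), multiply and shrink. [cite: CohnKleinbergSzegedyUmans2005, Def. 5.1] -/
theorem exists_isSTPP_222pow4_of_card {G : Type*} [AddCommGroup G] [Finite G] (hG : 16900 ≤ Nat.card G) :
    ∃ A B C : Fin 4 → Finset G, IsSTPP A B C ∧ ∀ i, (A i).card = 2 ∧ (B i).card = 2 ∧ (C i).card = 2 := by
  classical
  by_cases hexp : 72 ≤ AddMonoid.exponent G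
  · exact exists_isSTPP_2224_of_exponent_ge hexp
  push Not at hexp
  obtain ⟨ι, _, q, hq0, hdvd, hcard, ⟨f⟩⟩ := exists_addEquiv_pi_zmod G
  have hE : 0 < AddMonoid.exponent G := Nat.pos_of_ne_zero AddMonoid.exponent_ne_zero_of_finite
  have hq71 : ∀ i, q i ≤ 71 := fun i => by
    have := Nat.le_of_dvd hE (hdvd i); omega
  -- a block `S` with `26 ≤ ∏_S q` and `26 · ∏_S q ≤ ∏ q`
  obtain ⟨S, hS26, hSle⟩ : ∃ S : Finset ι, 26 ≤ ∏ i ∈ S, q i ∧ (∏ i ∈ S, q i) * 26 ≤ ∏ i, q i := by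
    by_cases hbig : ∃ i, 26 ≤ q i
    · obtain ⟨i, hi⟩ := hbig
      refine ⟨{i}, by rw [prod_singleton]; exact hi, ?_⟩
      rw [prod_singleton]
      calc q i * 26 ≤ 71 * 26 := Nat.mul_le_mul_right _ (hq71 i)
        _ ≤ ∏ i, q i := by rw [hcard]; omega
    · push Not at hbig
      obtain ⟨t, -, ht1, ht2⟩ := exists_subset_prod_window q (T := 26) (M := 25) (by norm_num) (by norm_num)
        hq0 (fun i => Nat.le_of_lt_succ (hbig i)) univ (by rw [hcard]; omega)
      refine ⟨t, ht1, ?_⟩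
      calc (∏ i ∈ t, q i) * 26 ≤ 649 * 26 := Nat.mul_le_mul_right _ (by omega)
        _ ≤ ∏ i, q i := by rw [hcard]; omega
  -- hence the complementary block also has order `≥ 26`
  have hSc26 : 26 ≤ ∏ i ∈ Sᶜ, q i := by
    by_contra hlt
    push Not at hlt
    have hpos : 0 < ∏ i ∈ S, q i := by omega
    have h1 : (∏ i ∈ S, q i) * ∏ i ∈ Sᶜ, q i < (∏ i ∈ S, q i) * 26 := (Nat.mul_lt_mul_left hpos).2 hlt
    rw [Finset.prod_mul_prod_compl] at h1
    omega
  -- `(2,2,2)²` in each block (Pb47), product, shrink, transport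
  haveI : ∀ i, NeZero (q i) := fun i => ⟨(hq0 i).ne'⟩
  have h1 : ∃ A B C : Fin 2 → Finset (Π i : {i // i ∈ S}, ZMod (q i)), IsSTPP A B C ∧
      ∀ i, (A i).card = 2 ∧ (B i).card = 2 ∧ (C i).card = 2 :=
    exists_isSTPP_222sq_of_card (by rw [natCard_pi_zmod_mem]; exact hS26)
  have h2 : ∃ A B C : Fin 2 → Finset (Π i : {i // i ∉ S}, ZMod (q i)), IsSTPP A B C ∧
      ∀ i, (A i).card = 2 ∧ (B i).card = 2 ∧ (C i).card = 2 :=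
    exists_isSTPP_222sq_of_card (by rw [natCard_pi_zmod_not_mem]; exact hSc26)
  have h12 := exists_isSTPP_222pow_prod h1 h2 4 (by norm_num)
  obtain ⟨φ, hφ⟩ := exists_prodPi_injective (fun i => ZMod (q i)) S
  have h3 := exists_isSTPP_222pow_of_injective φ hφ h12
  exact exists_isSTPP_222pow_of_injective f.symm.toAddMonoidHom f.symm.injective h3

/-- Census name: `N₄ ≤ 16 900` — with the kernel cell `ℤ/56 ⊉ (2,2,2)⁴` of the census (engine ×2, not used) the
uniform threshold of Q7 at `k = 4` satisfies `57 ≤ N₄ ≤ 16 900`. [cite: CohnKleinbergSzegedyUmans2005, Def. 5.1] -/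
theorem stpp222Pow4From16900 {G : Type*} [AddCommGroup G] [Finite G] (hG : 16900 ≤ Nat.card G) :
    ∃ A B C : Fin 4 → Finset G, IsSTPP A B C ∧ ∀ i, (A i).card = 2 ∧ (B i).card = 2 ∧ (C i).card = 2 :=
  exists_isSTPP_222pow4_of_card hG

/-! ## 4. `N_k < ∞` for every `k`, with the explicit envelope `(416 k² + 416)^k` -/

/-- Arithmetic: the exponent threshold `8k(k−1)+8` of `STPP222PowCyclic.lean` is at most `8k² + 8`. -/
theorem cyclicThreshold_le_sq (k : ℕ) : 8 * k * (k - 1) + 8 ≤ 8 * k ^ 2 + 8 := by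
  cases k with
  | zero => simp
  | succ j =>
      rw [Nat.succ_sub_one]
      nlinarith [sq_nonneg j]

/-- The induction behind `exists_isSTPP_222pow_of_card_ge`, over groups in `Type` (the universe in which the structure
theorem delivers `Π i, ℤ/qᵢ`): every finite abelian group of order `≥ (416 k² + 416)^k` admits `(2,2,2)^k`.  Base `k ≤ 2`:
the empty family, Pb49 (`≥ 10`), Pb47 (`≥ 26`).  Step (`k ≥ 3`, `k' = ⌈k/2⌉`): exponent `≥ 8k(k−1)+8` is the cyclic
theorem; otherwise every cyclic factor is `≤ 16k² + 16`, a greedy block of order in `[26, 416k²+416)` carries `(2,2,2)²`,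
the complementary block has order `≥ (416k²+416)^{k−1} ≥ (416k'²+416)^{k'}` and carries `(2,2,2)^{k'}` by induction;
multiply, shrink (`2k' ≥ k`), transport. [cite: CohnKleinbergSzegedyUmans2005, Def. 5.1] -/
theorem exists_isSTPP_222pow_of_card_ge_aux (k : ℕ) :
    ∀ (G : Type) [AddCommGroup G] [Finite G], (416 * k ^ 2 + 416) ^ k ≤ Nat.card G →
      ∃ A B C : Fin k → Finset G, IsSTPP A B C ∧ ∀ i, (A i).card = 2 ∧ (B i).card = 2 ∧ (C i).card = 2 := by
  induction k using Nat.strong_induction_on with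
  | _ k ih =>
    intro G _ _ hG
    classical
    rcases Nat.lt_or_ge k 3 with hk3 | hk3
    · interval_cases k
      · exact ⟨fun _ => ∅, fun _ => ∅, fun _ => ∅, fun i => i.elim0, fun i => i.elim0⟩
      · exact exists_isSTPP_222one_of_card (le_trans (by norm_num) hG)
      · exact exists_isSTPP_222sq_of_card (le_trans (by norm_num) hG)
    -- k ≥ 3
    set M : ℕ := 416 * k ^ 2 + 416 with hMdef
    set k' : ℕ := (k + 1) / 2 with hk'def
    have hk'lt : k' < k := by omega
    have hkk' : k ≤ 2 * k' := by omega
    have hMpos : 0 < M := by omega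
    by_cases hexp : 8 * k * (k - 1) + 8 ≤ AddMonoid.exponent G
    · exact exists_isSTPP_222pow_of_exponent k hexp
    push Not at hexp
    obtain ⟨ι, _, q, hq0, hdvd, hcard, ⟨f⟩⟩ := exists_addEquiv_pi_zmod G
    have hE : 0 < AddMonoid.exponent G := Nat.pos_of_ne_zero AddMonoid.exponent_ne_zero_of_finite
    have hqM : ∀ i, q i ≤ 16 * k ^ 2 + 16 := fun i => by
      have h1 := Nat.le_of_dvd hE (hdvd i)
      have h2 := cyclicThreshold_le_sq k
      omega
    -- the power bookkeeping: M^k = M * M^(k-1) ≤ |G|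
    have hMk : M * M ^ (k - 1) = M ^ k := by
      rw [← pow_succ']; congr 1; omega
    have h26 : 26 ≤ ∏ i, q i := by
      rw [hcard]
      refine le_trans ?_ hG
      calc 26 ≤ M := by omega
        _ ≤ M ^ k := Nat.le_self_pow (by omega) M
    -- a block `t` with `26 ≤ ∏_t q < 26 · (16k²+16) = M`
    obtain ⟨t, -, ht1, ht2⟩ := exists_subset_prod_window q (T := 26) (M := 16 * k ^ 2 + 16) (by norm_num)
      (by omega) hq0 hqM univ h26
    have htM : ∏ i ∈ t, q i < M := by rw [hMdef]; omega
    -- the complementary block has order `≥ M^(k-1) ≥ (416 k'² + 416)^k'`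
    have hcompl : M ^ (k - 1) ≤ ∏ i ∈ tᶜ, q i := by
      by_contra hlt
      push Not at hlt
      have hpos : 0 < ∏ i ∈ t, q i := by omega
      have h1 : (∏ i ∈ t, q i) * ∏ i ∈ tᶜ, q i < (∏ i ∈ t, q i) * M ^ (k - 1) :=
        (Nat.mul_lt_mul_left hpos).2 hlt
      have h2 : (∏ i ∈ t, q i) * M ^ (k - 1) ≤ M * M ^ (k - 1) := Nat.mul_le_mul_right _ htM.le
      rw [Finset.prod_mul_prod_compl, hcard] at h1
      rw [hMk] at h2
      omega
    have hbound' : (416 * k' ^ 2 + 416) ^ k' ≤ ∏ i ∈ tᶜ, q i := by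
      refine le_trans ?_ hcompl
      have hkk : k' ^ 2 ≤ k ^ 2 := Nat.pow_le_pow_left hk'lt.le 2
      calc (416 * k' ^ 2 + 416) ^ k' ≤ M ^ k' := Nat.pow_le_pow_left (by omega) k'
        _ ≤ M ^ (k - 1) := Nat.pow_le_pow_right hMpos (by omega)
    -- the two blocks as groups
    haveI : ∀ i, NeZero (q i) := fun i => ⟨(hq0 i).ne'⟩
    have h1 : ∃ A B C : Fin 2 → Finset (Π i : {i // i ∈ t}, ZMod (q i)), IsSTPP A B C ∧
        ∀ i, (A i).card = 2 ∧ (B i).card = 2 ∧ (C i).card = 2 :=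
      exists_isSTPP_222sq_of_card (by rw [natCard_pi_zmod_mem]; exact ht1)
    have h2 : ∃ A B C : Fin k' → Finset (Π i : {i // i ∉ t}, ZMod (q i)), IsSTPP A B C ∧
        ∀ i, (A i).card = 2 ∧ (B i).card = 2 ∧ (C i).card = 2 :=
      ih k' hk'lt (Π i : {i // i ∉ t}, ZMod (q i)) (by rw [natCard_pi_zmod_not_mem]; exact hbound')
    have h12 := exists_isSTPP_222pow_prod h1 h2 k hkk'
    obtain ⟨φ, hφ⟩ := exists_prodPi_injective (fun i => ZMod (q i)) t
    have h3 := exists_isSTPP_222pow_of_injective φ hφ h12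
    exact exists_isSTPP_222pow_of_injective f.symm.toAddMonoidHom f.symm.injective h3

/-- **`N_k < ∞` for every `k` (explicit): every finite abelian group of order `≥ (416 k² + 416)^k` admits `k`
simultaneous-TPP triples of 2-subsets** (the census pattern `(2,2,2)^k`; STRUCTURE Q7: the uniform threshold satisfies
`8k − 4 ≤ N_k ≤ (416 k² + 416)^k`; the recursion in the proof actually gives the quasi-polynomial `k^{O(log k)}`, the stated
closed form is the simple envelope; no sharpness claimed). [cite: CohnKleinbergSzegedyUmans2005, Def. 5.1] -/
theorem exists_isSTPP_222pow_of_card_ge (k : ℕ) {G : Type*} [AddCommGroup G] [Finite G]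
    (hG : (416 * k ^ 2 + 416) ^ k ≤ Nat.card G) :
    ∃ A B C : Fin k → Finset G, IsSTPP A B C ∧ ∀ i, (A i).card = 2 ∧ (B i).card = 2 ∧ (C i).card = 2 := by
  classical
  obtain ⟨ι, _, q, hq0, -, hcard, ⟨f⟩⟩ := exists_addEquiv_pi_zmod G
  haveI : ∀ i, NeZero (q i) := fun i => ⟨(hq0 i).ne'⟩
  have hcard' : Nat.card (Π i, ZMod (q i)) = Nat.card G := by
    rw [Nat.card_pi, ← hcard]; simp
  have h := exists_isSTPP_222pow_of_card_ge_aux k (Π i, ZMod (q i)) (by rw [hcard']; exact hG)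
  exact exists_isSTPP_222pow_of_injective f.symm.toAddMonoidHom f.symm.injective h

end Summit.MatrixMultiplication.OmegaCensus
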